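import Summits.ValiantsHypothesis.ValiantsHypothesis.Theorems.GeneratorObstructionsPerGenDegreeSuperQPCollapseDesigns

/-!
# Route GeneratorObstructions — K1 `PerGenDegreeSuperQP` (stmt-ValiantsHypothesis-11654),
# line `per-side-atoms`: SINGER DESIGNS — a perfect difference set of size `m` hits the LONG ray
# `j = m² - m + 1` of `S(per_m)`; instances `m = 3, 4, 5, 6` (rays `7, 13, 21, 31`)

First application of the design criterion (`…CollapseDesigns`, `per_ray_hit_of_additive_design`)
beyond the short rays. Let `a : [m] ↪ ℤ/j` be a PERFECT DIFFERENCE SET: every nonzero residue is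
a difference `a(i') - a(i)` in exactly one way (then necessarily `j - 1 = m(m-1)`, i.e.
`j = m² - m + 1 = q² + q + 1` with `q = m - 1`; Singer 1938: such sets exist for every prime power
`q`). The additive labels `ℓ(i', i) = a(i') - a(i)` put the label `0` on the diagonal (`m` cells)
and every nonzero label on exactly one off-diagonal cell, so the matrix
`M = (m/(m²-m+1)) (J - I) + (1/(m²-m+1)) I` — doubly stochastic, positive — has FLAT `ℓ`-profile
`m/(m²-m+1)`, and the criterion gives:

* `per_ray_hit_of_perfectDifferenceSet` — **a perfect difference set `a : [m] ↪ ℤ/j` (`j ≤ m²`)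
  makes the chamber ray `(1^j)^*` of `S(per_m)` hit** (with an atom at its first weight,
  `per_exists_ray_atom_of_perfectDifferenceSet`);
* instances by `decide` on the Singer sets `{0,1,3} ⊂ ℤ/7`, `{0,1,3,9} ⊂ ℤ/13`,
  `{0,1,4,14,16} ⊂ ℤ/21`, `{0,1,3,8,12,18} ⊂ ℤ/31`: **ray 7 of `S(per_3)`, ray 13 of `S(per_4)`,
  ray 21 of `S(per_5)`, ray 31 of `S(per_6)` are hit** — none of them a product or sum of two
  divisors of `m`, and (exact LP over all additive designs, this session) ray 13 of `S(per_4)` has NO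
  design with `a = id`.

With `…ModularCollapseRays` (all `j ≤ m`) and the divisor families, the chamber-ray table of
`S(per_3)` is now: rays `1,…,7` and `9` hit; ray `8 = m² - 1` admits no labelled design (one forced
collision) and stays open. Honest framing: unconditional occupancy theorems; the existence of
perfect difference sets for all prime powers (Singer) is NOT formalised here (instances only);
`stub_atomLate` (`c ≥ 2`), K1 and `GenFlipThesis` remain OPEN; nothing bears on VP versus VNP.
References: J. Singer, *A theorem in finite projective geometry and some applications to number
theory*, Trans. AMS 43 (1938) 377–385; [BurgisserIkenmeyer2017] Prop. 2.8 (corrected), Def. 3.3.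
-/

set_option linter.dupNamespace false

noncomputable section

namespace Summit.ValiantsHypothesis.ValiantsHypothesis.Theorems.GeneratorObstructions.PerGenDegreeSuperQP

open MvPolynomial
open Literature.NumberTheory.DiophantineGeometry Literature.Computability.AlgebraicComplexity
  Literature.Computability.Complexity

section Singer

variable {m j : ℕ} [NeZero j]

/-- **Singer designs hit long rays.** Let `a : [m] → ℤ/j` be injective with every nonzero residue
a difference `a i' - a i` in exactly one way (a perfect difference set; stated decidably as
`#{p : a p.1 - a p.2 = y} = 1`), and `j ≤ m²`. Then the
chamber ray `(1^j)^*` of `S(per_m)` is hit: the additive design `ℓ(i',i) = a i' - a i` with the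
flat positive coupling `M = (m (J - I) + I)/(m² - m + 1)`. [cite: BurgisserIkenmeyer2017, Prop. 2.8 and Def. 3.3] -/
theorem per_ray_hit_of_perfectDifferenceSet (hjm : j ≤ m * m) (a : Fin m → Fin j)
    (ha : Function.Injective a)
    (hdiff : ∀ y : Fin j, y ≠ 0 →
      (Finset.univ.filter fun p : Fin m × Fin m => a p.1 - a p.2 = y).card = 1) :
    ∃ k : ℕ, 0 < k ∧
      highestWeightSpace (orbitCoordRep (MvPolynomial.rename toLex (perPoly (Fin m) ℂ)) m)
        (partitionWeightLex m (Nat.Partition.rectangle j k)) ≠ ⊥ := by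
  classical
  set D : ℚ := (m : ℚ) * m - m + 1 with hD
  have hDpos : 0 < D := by rw [hD]; nlinarith [sq_nonneg ((m : ℚ) - 1)]
  have hm : 0 < m := by
    rcases Nat.eq_zero_or_pos m with h | h
    · subst h
      exact absurd hjm (by have := NeZero.ne j; omega)
    · exact h
  set M : Matrix (Fin m) (Fin m) ℚ := fun i i' => if i = i' then 1 / D else (m : ℚ) / D with hMdef
  have hMpos : ∀ i i', 0 < M i i' := by
    intro i i'
    rw [hMdef]
    simp only
    split_ifs <;> positivity
  have hline : ∀ i, ∑ i', M i i' = 1 := by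
    intro i
    rw [hMdef]
    simp only
    rw [Finset.sum_ite, Finset.sum_const, Finset.sum_const, Finset.filter_eq, if_pos (Finset.mem_univ _),
      Finset.card_singleton, Finset.filter_ne, Finset.card_erase_of_mem (Finset.mem_univ _),
      Finset.card_univ, Fintype.card_fin, nsmul_eq_mul, nsmul_eq_mul]
    have hm1 : ((m - 1 : ℕ) : ℚ) = (m : ℚ) - 1 := by
      rw [Nat.cast_sub (by omega), Nat.cast_one]
    have hgoal : (1 : ℚ) / D + ((m : ℚ) - 1) * ((m : ℚ) / D) = 1 := by
      rw [mul_div_assoc', ← add_div, div_eq_one_iff_eq hDpos.ne', hD]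
      ring
    rw [hm1]
    simpa [Nat.cast_one, one_mul] using hgoal
  have hcol : ∀ i', ∑ i, M i i' = 1 := by
    intro i'
    have hsymm : ∀ i, M i i' = M i' i := by
      intro i; rw [hMdef]; simp only [eq_comm]
    simp_rw [hsymm]
    exact hline i'
  refine per_ray_hit_of_additive_design hjm a (fun i => -a i) M hMpos hline hcol ((m : ℚ) / D)
    (by positivity) fun y => ?_
  by_cases hy : y = 0
  · subst hy
    have hinner : ∀ i : Fin m, ∑ i' : Fin m, (if a i' + -a i = 0 then M i i' else 0) = 1 / D := by
      intro i
      have hiff : ∀ i', (a i' + -a i = 0) ↔ (i' = i) := by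
        intro i'
        rw [← sub_eq_add_neg, sub_eq_zero]
        exact ⟨fun h => ha h, fun h => by rw [h]⟩
      simp_rw [hiff]
      rw [Finset.sum_ite_eq' Finset.univ i, if_pos (Finset.mem_univ _), hMdef]
      exact if_pos rfl
    simp_rw [hinner]
    rw [Finset.sum_const, Finset.card_univ, Fintype.card_fin, nsmul_eq_mul, mul_one_div]
  · obtain ⟨p, hpeq⟩ := Finset.card_eq_one.mp (hdiff y hy)
    have hp : a p.1 - a p.2 = y := by
      have : p ∈ Finset.univ.filter (fun p : Fin m × Fin m => a p.1 - a p.2 = y) := by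
        rw [hpeq]; exact Finset.mem_singleton_self p
      exact (Finset.mem_filter.mp this).2
    have huniq : ∀ q : Fin m × Fin m, a q.1 - a q.2 = y → q = p := by
      intro q hq
      have : q ∈ Finset.univ.filter (fun p : Fin m × Fin m => a p.1 - a p.2 = y) :=
        Finset.mem_filter.mpr ⟨Finset.mem_univ _, hq⟩
      rw [hpeq] at this
      exact Finset.mem_singleton.mp this
    have hp12 : p.1 ≠ p.2 := by
      intro h
      apply hy
      rw [← hp, h, sub_self]
    rw [← Finset.sum_product' Finset.univ Finset.univ (fun i i' => if a i' + -a i = y then M i i' else 0)]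
    rw [Finset.sum_eq_single (p.2, p.1)]
    · show (if a p.1 + -a p.2 = y then M p.2 p.1 else 0) = (m : ℚ) / D
      rw [← sub_eq_add_neg, if_pos hp, hMdef]
      exact if_neg (Ne.symm hp12)
    · intro q _ hq
      show (if a q.2 + -a q.1 = y then M q.1 q.2 else 0) = 0
      rw [← sub_eq_add_neg, if_neg]
      intro h
      apply hq
      have := huniq (q.2, q.1) h
      exact Prod.ext (by simpa using congrArg Prod.snd this) (by simpa using congrArg Prod.fst this)
    · intro h
      exact absurd (Finset.mem_univ _) h

/-- **Singer designs, atom form**: under the hypotheses of `per_ray_hit_of_perfectDifferenceSet` the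
ray `j` of `S(per_m)` starts with an ATOM `(k₀^j)^*`. [cite: BurgisserIkenmeyer2017, Prop. 2.8 and Def. 3.3] -/
theorem per_exists_ray_atom_of_perfectDifferenceSet (hjm : j ≤ m * m) (a : Fin m → Fin j)
    (ha : Function.Injective a)
    (hdiff : ∀ y : Fin j, y ≠ 0 →
      (Finset.univ.filter fun p : Fin m × Fin m => a p.1 - a p.2 = y).card = 1) :
    ∃ k₀ : ℕ, 0 < k₀ ∧
      highestWeightSpace (orbitCoordRep (MvPolynomial.rename toLex (perPoly (Fin m) ℂ)) m)
        (partitionWeightLex m (Nat.Partition.rectangle j k₀)) ≠ ⊥ ∧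
      (∀ k : ℕ, 0 < k → k < k₀ →
        highestWeightSpace (orbitCoordRep (MvPolynomial.rename toLex (perPoly (Fin m) ℂ)) m)
          (partitionWeightLex m (Nat.Partition.rectangle j k)) = ⊥) ∧
      (∀ χ₁ χ₂ : Weight (MatIdx m),
        χ₁ + χ₂ = partitionWeightLex m (Nat.Partition.rectangle j k₀) →
        χ₁ ≠ 0 → χ₂ ≠ 0 →
        highestWeightSpace (orbitCoordRep (MvPolynomial.rename toLex (perPoly (Fin m) ℂ)) m) χ₁ = ⊥ ∨
          highestWeightSpace (orbitCoordRep (MvPolynomial.rename toLex (perPoly (Fin m) ℂ)) m) χ₂ = ⊥) :=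
  exists_least_rectangle_atom _ _ (Nat.pos_of_ne_zero (NeZero.ne j)) hjm
    (per_ray_hit_of_perfectDifferenceSet hjm a ha hdiff)

end Singer

/-! ### Instances: the Singer sets for `q = 2, 3, 4, 5` -/

section Instances

/-- **Ray 7 of `S(per_3)` is hit** — the Fano difference set `{0, 1, 3} ⊂ ℤ/7`. [folklore] -/
theorem per_three_ray_seven_hit :
    ∃ k : ℕ, 0 < k ∧
      highestWeightSpace (orbitCoordRep (MvPolynomial.rename toLex (perPoly (Fin 3) ℂ)) 3)
        (partitionWeightLex 3 (Nat.Partition.rectangle 7 k)) ≠ ⊥ :=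
  per_ray_hit_of_perfectDifferenceSet (m := 3) (j := 7) (by norm_num) ![0, 1, 3] (by decide) (by decide)

/-- **Ray 13 of `S(per_4)` is hit** — the Singer set `{0, 1, 3, 9} ⊂ ℤ/13` (`PG(2,3)`). [folklore] -/
theorem per_four_ray_thirteen_hit :
    ∃ k : ℕ, 0 < k ∧
      highestWeightSpace (orbitCoordRep (MvPolynomial.rename toLex (perPoly (Fin 4) ℂ)) 4)
        (partitionWeightLex 4 (Nat.Partition.rectangle 13 k)) ≠ ⊥ :=
  per_ray_hit_of_perfectDifferenceSet (m := 4) (j := 13) (by norm_num) ![0, 1, 3, 9] (by decide)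
    (by decide)

/-- **Ray 21 of `S(per_5)` is hit** — the Singer set `{0, 1, 4, 14, 16} ⊂ ℤ/21` (`PG(2,4)`).
[folklore] -/
theorem per_five_ray_twentyone_hit :
    ∃ k : ℕ, 0 < k ∧
      highestWeightSpace (orbitCoordRep (MvPolynomial.rename toLex (perPoly (Fin 5) ℂ)) 5)
        (partitionWeightLex 5 (Nat.Partition.rectangle 21 k)) ≠ ⊥ :=
  per_ray_hit_of_perfectDifferenceSet (m := 5) (j := 21) (by norm_num) ![0, 1, 4, 14, 16] (by decide)
    (by decide)

/-- **Ray 31 of `S(per_6)` is hit** — the Singer set `{0, 1, 3, 8, 12, 18} ⊂ ℤ/31` (`PG(2,5)`).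
[folklore] -/
theorem per_six_ray_thirtyone_hit :
    ∃ k : ℕ, 0 < k ∧
      highestWeightSpace (orbitCoordRep (MvPolynomial.rename toLex (perPoly (Fin 6) ℂ)) 6)
        (partitionWeightLex 6 (Nat.Partition.rectangle 31 k)) ≠ ⊥ :=
  per_ray_hit_of_perfectDifferenceSet (m := 6) (j := 31) (by norm_num) ![0, 1, 3, 8, 12, 18]
    (by decide) (by decide)

end Instances

end Summit.ValiantsHypothesis.ValiantsHypothesis.Theorems.GeneratorObstructions.PerGenDegreeSuperQP

end
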